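import Summits.Ventures.PercRepro.S1DisjointSumFiveFourProfile

/-!
# PercRepro — THE `(5, 4)`-SPLIT CONSUMER AT `(9, 4)`: A COLOOP-FREE RANK-5 PART ON 8 POINTS ⊕ A SIMPLE RANK-4
PART ON 6 POINTS (p2, gen 28; SUBCLAIM-S1 §6.10 (xvii)(j))

The second non-circuit `1`-separable shape of the `(9, 5)` cell: `M` coloop-free of rank `5` on `8` points
(corank `3`) and `N` of rank `4` on `6` points (corank `2`) with every pair of distinct points of rank `2`. Then
`#U(M ⊕ N; 9, 4) ≤ 6 N_M(5, 3) + 15 N_M(5, 2)` (`N_N(4, 1) ≤ 6`, `N_N(4, 2) ≤ C(6, 4) = 15`, `N_N(4, ≥ 3) = ∅`,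
`N_M(5, 4) = ∅`) and `#Y(M ⊕ N; 9, 4) ≥ 42 f_M(5) + 63 f_M(4) + 57 f_M(3)` (`S1DisjointSumFiveFourProfile`).
Theorem M at `(5, 3)` (`Φ = 5/4`), Theorem N at `(5, 2)` (`Φ = 10/3`) and the coloop-free double count
`2 f_M(4) ≤ 5 f_M(5)` give `Φ(9, 4) · #U ≤ 37.8 f_M(3) + 78.12 f_M(4) ≤ 57 f_M(3) + 63 f_M(4) + 42 f_M(5)`.
Nothing is claimed about any cell.

* `ncard_U_disjointSum_five_four_le`, `ncard_Y_disjointSum_five_four_ge`, `consumer_arith_five_four`;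
* **`c025_nine_four_disjointSum_five_four`** — the consumer.
Axioms: standard.
-/

open scoped Matroid

namespace PercRepro

namespace S1

open Set

variable {α : Type}

/-- **The `U`-side of the `(5, 4)` split**: `#U(M ⊕ N; 9, 4) ≤ 6 N_M(5, 3) + 15 N_M(5, 2)`. -/
theorem ncard_U_disjointSum_five_four_le (M N : Matroid α) [M.Finite] [N.Finite] (h : Disjoint M.E N.E)
    (hM : M.eRank = ((5 : ℕ) : ℕ∞)) (hME : M.E.ncard = 8) (hN : N.eRank = ((4 : ℕ) : ℕ∞))
    (hNE : N.E.ncard = 6) (hpairs : ∀ e ∈ N.E, ∀ f ∈ N.E, e ≠ f → N.eRk {e, f} = 2) :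
    {A : Set α | A ⊆ (M.disjointSum N h).E ∧ (M.disjointSum N h).eRk A = ((9 : ℕ) : ℕ∞) ∧
        (M.disjointSum N h).eRk ((M.disjointSum N h).E \ A) = ((4 : ℕ) : ℕ∞)}.ncard ≤
      6 * (profileSet M 5 3).ncard + 15 * (profileSet M 5 2).ncard := by
  rw [disjointSum_ncard_U_eq_finsum M N h 9 4, finsum_mem_coe_finset]
  rw [Finset.sum_eq_add_of_mem (5, 3) (5, 2) (by decide) (by decide) (by decide) ?_]
  · dsimp only
    rw [show (9 : ℕ) - 5 = 4 from rfl, show (4 : ℕ) - 3 = 1 from rfl, show (4 : ℕ) - 2 = 2 from rfl]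
    have h1 := ncard_profileSet_top_one_le_of_pairs' hpairs 4
    rw [hNE] at h1
    have h2 := ncard_profileSet_le_choose_of_ncard_eq (N := N) (a := 4) (b := 2) hNE
    rw [show Nat.choose (4 + 2) 4 = 15 by decide] at h2
    calc (profileSet M 5 3).ncard * (profileSet N 4 1).ncard + (profileSet M 5 2).ncard * (profileSet N 4 2).ncard
        ≤ (profileSet M 5 3).ncard * 6 + (profileSet M 5 2).ncard * 15 :=
          Nat.add_le_add (Nat.mul_le_mul_left _ h1) (Nat.mul_le_mul_left _ h2)
      _ = 6 * (profileSet M 5 3).ncard + 15 * (profileSet M 5 2).ncard := by ring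
  · rintro ⟨a, b⟩ hmem ⟨hne1, hne2⟩
    rw [Finset.mem_product, Finset.mem_range, Finset.mem_range] at hmem
    dsimp only
    rcases Nat.lt_or_ge 5 a with ha | ha
    · rw [profileSet_eq_empty_of_eRank_lt M hM ha b, ncard_empty, zero_mul]
    rcases Nat.lt_or_ge a 5 with ha' | ha'
    · have h9a : 4 < 9 - a := by omega
      rw [profileSet_eq_empty_of_eRank_lt N hN h9a (4 - b), ncard_empty, mul_zero]
    have ha5 : a = 5 := by omega
    subst ha5
    rw [show (9 : ℕ) - 5 = 4 from rfl]
    rcases Nat.lt_or_ge b 2 with hb | hb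
    · -- `b ≤ 1`: the `N`-complement would need `≥ 3` points beside a spanning set of `≥ 4` points
      have h6 : N.E.ncard < 4 + (4 - b) := by rw [hNE]; omega
      rw [profileSet_eq_empty_of_ncard_lt N h6, ncard_empty, mul_zero]
    · have hb4 : b = 4 := by
        rcases Nat.lt_or_ge b 4 with hb4 | hb4
        · exfalso
          rcases Nat.lt_or_ge b 3 with hb3 | hb3
          · exact hne2 (by congr 1; omega)
          · exact hne1 (by congr 1; omega)
        · omega
      subst hb4
      rw [profileSet_eq_empty_of_ncard_lt M (by rw [hME]; norm_num : M.E.ncard < 5 + 4), ncard_empty,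
        zero_mul]

/-- **The `Y`-side of the `(5, 4)` split**: `#Y(M ⊕ N; 9, 4) ≥ 42 f_M(5) + 63 f_M(4) + 57 f_M(3)`. -/
theorem ncard_Y_disjointSum_five_four_ge (M N : Matroid α) [M.Finite] [N.Finite] (h : Disjoint M.E N.E)
    (hN : N.eRank = ((4 : ℕ) : ℕ∞)) (hNE : N.E.ncard = 6)
    (hpairs : ∀ e ∈ N.E, ∀ f ∈ N.E, e ≠ f → N.eRk {e, f} = 2) :
    42 * (rankSet M 5).ncard + 63 * (rankSet M 4).ncard + 57 * (rankSet M 3).ncard ≤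
      {A : Set α | A ⊆ (M.disjointSum N h).E ∧ ((4 : ℕ) : ℕ∞) < (M.disjointSum N h).eRk A ∧
        (M.disjointSum N h).eRk A < ((9 : ℕ) : ℕ∞)}.ncard := by
  rw [disjointSum_ncard_Y_eq_finsum M N h 9 4, finsum_mem_coe_finset]
  have hsub : ({(5, 0), (5, 1), (5, 2), (5, 3), (4, 1), (4, 2), (4, 3), (4, 4), (3, 2), (3, 3), (3, 4)} :
      Finset (ℕ × ℕ)) ⊆
      (Finset.range 9 ×ˢ Finset.range 9).filter (fun x : ℕ × ℕ => 4 < x.1 + x.2 ∧ x.1 + x.2 < 9) := by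
    decide
  refine le_trans ?_ (Finset.sum_le_sum_of_subset hsub)
  rw [Finset.sum_insert (by decide), Finset.sum_insert (by decide), Finset.sum_insert (by decide),
    Finset.sum_insert (by decide), Finset.sum_insert (by decide), Finset.sum_insert (by decide),
    Finset.sum_insert (by decide), Finset.sum_insert (by decide), Finset.sum_insert (by decide),
    Finset.sum_insert (by decide), Finset.sum_singleton]
  dsimp only
  have s03 := ncard_rankSet_sum_ge_of_pairs_zero_three (N := N) hNE
  have s14 := ncard_rankSet_sum_ge_of_pairs_one_four hpairs hN hNE
  have s24 := ncard_rankSet_sum_ge_of_pairs_two_four hpairs hN hNE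
  have e5 := Nat.mul_le_mul_left (rankSet M 5).ncard s03
  have e4 := Nat.mul_le_mul_left (rankSet M 4).ncard s14
  have e3 := Nat.mul_le_mul_left (rankSet M 3).ncard s24
  rw [mul_add, mul_add, mul_add] at e5 e4
  rw [mul_add, mul_add] at e3
  linarith

/-- The arithmetic of the `(5, 4)`-split consumer: `u ≤ 6 P₃ + 15 P₂`, `(5/4) P₃ ≤ f₄`, `(10/3) P₂ ≤ f₃ + f₄`,
`2 f₄ ≤ 5 f₅`, `y ≥ 42 f₅ + 63 f₄ + 57 f₃` give `(42/5) u ≤ y`. -/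
theorem consumer_arith_five_four {u y P3 P2 f3 f4 f5 : ℚ} (hU : u ≤ 6 * P3 + 15 * P2)
    (h53 : 5 / 4 * P3 ≤ f4) (h52 : 10 / 3 * P2 ≤ f3 + f4) (hdc : 2 * f4 ≤ (4 + 1) * f5)
    (hY : 42 * f5 + 63 * f4 + 57 * f3 ≤ y) (hf3 : 0 ≤ f3) (hf4 : 0 ≤ f4) : 42 / 5 * u ≤ y := by
  linarith

/-- **THE `(5, 4)`-SPLIT CONSUMER**: `Φ(9, 4) · #U(M ⊕ N; 9, 4) ≤ #Y(M ⊕ N; 9, 4)` for every finite coloop-free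
`M` of rank `5` on `8` points and every finite `N` of rank `4` on `6` points whose pairs of distinct points all
have rank `2` — from Theorem M at `(5, 3)`, Theorem N at `(5, 2)` and the double count on `M`. -/
theorem c025_nine_four_disjointSum_five_four (M N : Matroid α) [M.Finite] [N.Finite]
    (h : Disjoint M.E N.E) (hM : M.eRank = ((5 : ℕ) : ℕ∞)) (hME : M.E.ncard = 8) (hcol : M.coloops = ∅)
    (hN : N.eRank = ((4 : ℕ) : ℕ∞)) (hNE : N.E.ncard = 6)
    (hpairs : ∀ e ∈ N.E, ∀ f ∈ N.E, e ≠ f → N.eRk {e, f} = 2) :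
    phiK 9 4 * ({A : Set α | A ⊆ (M.disjointSum N h).E ∧ (M.disjointSum N h).eRk A = ((9 : ℕ) : ℕ∞) ∧
        (M.disjointSum N h).eRk ((M.disjointSum N h).E \ A) = ((4 : ℕ) : ℕ∞)}.ncard : ℚ) ≤
      ({A : Set α | A ⊆ (M.disjointSum N h).E ∧ ((4 : ℕ) : ℕ∞) < (M.disjointSum N h).eRk A ∧
        (M.disjointSum N h).eRk A < ((9 : ℕ) : ℕ∞)}.ncard : ℚ) := by
  have hU := ncard_U_disjointSum_five_four_le M N h hM hME hN hNE hpairs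
  have hY := ncard_Y_disjointSum_five_four_ge M N h hN hNE hpairs
  have h53 : (5 / 4 : ℚ) * ((profileSet M 5 3).ncard : ℚ) ≤ ((rankSet M 4).ncard : ℚ) := by
    have h0 := ThmN.RLS_of_ncard_eq M (p := 5) (q := 3) hME
    unfold ThmN.RLS at h0
    rw [ThmO.phiK_five_three, ySet_eq_rankSet_of_eq M (q := 3) (p := 5) (k := 4) rfl rfl] at h0
    exact h0
  have h52 : (10 / 3 : ℚ) * ((profileSet M 5 2).ncard : ℚ) ≤
      ((rankSet M 3).ncard : ℚ) + ((rankSet M 4).ncard : ℚ) := by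
    have h0 := ThmN.c025_two_all M 5 (by norm_num)
    unfold ThmN.RLS at h0
    rw [phiK_five_two, ySet_eq_rankSet_union_of_eq M (q := 2) (p := 5) (k := 3) (k' := 4) rfl rfl rfl,
      ncard_union_eq (rankSet_disjoint_of_ne M (by norm_num)) (rankSet_finite M 3) (rankSet_finite M 4)] at h0
    push_cast at h0
    exact h0
  have hM' : M.eRank = ((4 + 1 : ℕ) : ℕ∞) := hM
  have hdc := two_mul_ncard_rankSet_le M hM' hcol
  rw [phiK_nine_four]
  have hU' : (({A : Set α | A ⊆ (M.disjointSum N h).E ∧ (M.disjointSum N h).eRk A = ((9 : ℕ) : ℕ∞) ∧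
      (M.disjointSum N h).eRk ((M.disjointSum N h).E \ A) = ((4 : ℕ) : ℕ∞)}.ncard : ℕ) : ℚ) ≤
      6 * ((profileSet M 5 3).ncard : ℚ) + 15 * ((profileSet M 5 2).ncard : ℚ) := by
    exact_mod_cast hU
  have hY' : 42 * ((rankSet M 5).ncard : ℚ) + 63 * ((rankSet M 4).ncard : ℚ) + 57 * ((rankSet M 3).ncard : ℚ) ≤
      (({A : Set α | A ⊆ (M.disjointSum N h).E ∧ ((4 : ℕ) : ℕ∞) < (M.disjointSum N h).eRk A ∧
        (M.disjointSum N h).eRk A < ((9 : ℕ) : ℕ∞)}.ncard : ℕ) : ℚ) := by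
    exact_mod_cast hY
  have hdc' : 2 * ((rankSet M 4).ncard : ℚ) ≤ (4 + 1) * ((rankSet M 5).ncard : ℚ) := by
    exact_mod_cast hdc
  exact consumer_arith_five_four hU' h53 h52 hdc' hY' (Nat.cast_nonneg _) (Nat.cast_nonneg _)

end S1

end PercRepro
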